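import Summits.BirchSwinnertonDyer.BirchSwinnertonDyer.Theorems.ErratumRoadFiveNonSurjCornerKolyJSwap
import Summits.BirchSwinnertonDyer.BirchSwinnertonDyer.Theorems.ClassRecordThreeEulerHalvesAtThreeWalkFamiliesAdm
import HarnessLib

/-!
# The PRIME SWAP on the row objects — CORRECTED BINDER (`h44c` at Kolyvagin PRIMES `ℓ` only; supersedes p509046):
# `JET.Section6.exists_deep_conductor_of_swap` (p505956) instantiated on
# `H¹(K, E[p^k])` with tam3-p1's walk dictionary — every bookkeeping input DISCHARGED, the Čebotarev input KERNEL
# (corner: `E[p]` irreducible with `−1` in the image; or `ρ̄` onto), the remaining inputs NAMED and concrete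
# (cell `bsd-stepL`, seat `bsd-stepL-corner-p1` g8; `--supports stmt-BirchSwinnertonDyer-19947`; serves `stub_kolyJ_max`,
# the 19111 Upper kit's `stub_upper3_jetchevMax`, and 19109's `stub_jetchevMaxHLAtThree` alike)

ERRATUM (this file supersedes p509046 `…KolyJSwapRow`, exactly as tam3-p1's `…WalkFamiliesAdmPrime` superseded p497855):
there the hypothesis `h44c` (McCallum Prop. 4.4, non-vanishing form) quantifies over EVERY `ℓ` with `ℓ ∤ s`, `s' = sℓ`
admissible — including composite square-free `ℓ`, for which Prop. 4.4 is not a printed (or true) statement; that binder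
was stronger than print and no supply of it is to be expected. Here `h44c` carries `IsKolyvaginPrime … ℓ ∧ i₀ ≤ M(ℓ)`
(the swap only ever uses it at the primes of the pool); everything else is byte-for-byte p509046. The corollaries of
`…KolyJSwapRowCorner` (p510356) are re-issued on this file in `…KolyJSwapRowCornerPrime`.

WHAT. `Koly.kolyvaginRedefinition_of_swap` (`…KolyJRedefinition`, p507157) reduces the hK input of the three max-form
displays to `hswap` = «at the frame, for all `M e`: an admissible conductor over Kolyvagin primes of index `≥ M + 1`
whose derived point is not `p^{M+1}`-divisible — all conductors over index `≥ M + 1` being `p^M`-divisible — can be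
traded for one over primes of index `≥ e` with the same property». Its abstract kernel is the prime swap (p505956). THIS
FILE instantiates that kernel on the tree's objects EXACTLY as tam3-p1 instantiated the §6 walk
(`…EulerHalvesAtThreeWalkFamiliesAdm`, p497855): `G ↦ H¹(K, E[p^k])` (`galoisCohomology (torsionGaloisModule (p^k)) 1`),
`Gs s ↦ signPart τ (±1) ⊤`, `loc ℓ ↦ galoisCohomology.localization … (Sum.inr λ) 1`, `Sel n s ↦
signPart τ (±1) H_{𝓕(n)}` with `𝓕(n) = selmerF W (p^k) 𝒯 (placesDividing K n)`, `Rel n ℓ₀ s ↦` the same relaxed at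
`λ₀`, `Hf ∕ Htr ↦` (Kummer ∕ `𝒯`) `⊓ loc(sign-s classes)`, conductors `∏_{ℓ ∈ n} ℓ` over the pool
`P = {Kolyvagin primes of index ≥ i₀}`, `Deep ℓ ↦ e₀ ≤ M(ℓ)`. USE IT WITH `k = 1` (`i₀ = M + 1`): the perfectness input
`hperf` («finite^s × transverse^s non-degenerate between non-zero elements») holds for the local Tate pairing on
`H¹(K_λ, E[p])` (two LINES per sign) and FAILS at level `p^k`, `k ≥ 2` (see `…KolyJSwap`, module docstring NOTE).
DISCHARGED HERE: `hSelT`, `hRelf`, `hSelGs`, `hRelGs`, `he`, `haux` (from the duality count `hPT`), `h61` (from the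
concrete Čebotarev `h61c`, itself KERNEL — the specialisations `exists_deep_of_swapFamilies_of_irr_of_neg` (corner, via p501512) and
`…_of_surj` (via tam3's p494064) are in the sibling `…KolyJSwapRowCorner.lean`),
admissibility ∕ place bookkeeping, the passage conductor ↔ `Finset` of primes. NAMED HYPOTHESES LEFT (concrete):
`hPT` (the walk's, at the relaxed prime), the level-`p` LOCAL TATE PAIRING PACKAGE `pair` ∕ `hperf` ∕ `hrec` (cup product
+ Weil pairing; perfectness per sign; Poitou–Tate reciprocity for a relaxed class against a Selmer class with all terms
off `{λ₀, λ}` vanishing by isotropy — McCallum 1991 Prop. 2.2, Lemma 5.3), and the DICTIONARY of the level-`p` classes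
`κ̄_n` (`κb`: `hκSel` sign + local conditions = Gross Prop. 5.4 ∕ McCallum Lemma 4.3 ∕ [J] Prop. 4.9; `h44c` = McCallum
Prop. 4.4 in non-vanishing form; `hκ0` = «`κ̄_n ≠ 0 ↔ P_n ∉ p^{i₀}E(K[n])`», McCallum Cor. 4.5 for the level-`p` avatar
of `c_{i₀}(n)` — which exists because `c_{i₀}(n)` is `p`-torsion under the «all `p^{i₀−1}`-divisible» clause and
`E(K)[p] = 0`). CONCLUSION: `∃` an admissible conductor over primes of index `≥ e₀` whose datum is not
`p^{i₀}`-divisible — the `∃`-clause of `hswap` (with `i₀ = M + 1`, `e₀ = e`) for the family `D`; a caller holding an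
arbitrary datum `d` at the starting conductor feeds the family updated at that conductor.
HONEST FRAMING: one theorem, no definition, no named fact, no `sorry`; nothing here discharges `hPT`, the pairing
package or the `κ̄` dictionary; no stub closes; nothing asserted about any curve; BSD not advanced (T7).
References (locators only): [cite: McCallumLMS1991, §2 Prop. 2.2, §3 Cor. 3.2, §4 Lemma 4.3, Prop. 4.4, Cor. 4.5, §5
Prop. 5.2, Lemma 5.3 (pp. 297–306)] [cite: BurungaleEtAl2026, Prop. 2.2.1 (§2.2)] [cite: Jetchev2008, §3.4.1, Lemma 5.1
(pp. 816, 821)] [cite: GrossLMS1991, Prop. 5.4]. Design: `K : Type`; `Type`-valued pairing target. Axioms: std.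
-/

set_option autoImplicit false

noncomputable section

open scoped Classical NumberField

namespace Summit.BirchSwinnertonDyer.Rank1Residual.X11b.Three.Koly

open WeierstrassCurve IsDedekindDomain NumberField Literature.NumberTheory.EllipticCurves
  Literature.NumberTheory.EllipticCurves.ModularForms Literature.NumberTheory.EllipticCurves.Jetchev2008
  Literature.NumberTheory.GaloisRepresentations
  Literature.NumberTheory.GaloisRepresentations.DiscreteGaloisModule
  Summit.BirchSwinnertonDyer.Rank1Residual.JET

/-- **The prime swap on the row objects** (McCallum 1991 Prop. 5.2, `C = {0}`, stable range; BCGS Prop. 2.2.1), the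
abstract `JET.Section6.exists_deep_conductor_of_swap` instantiated with the walk's dictionary (module docstring; use
with `k = 1`). Frame `(Dt, β, ι)`, prime `p`, `τ`, level `p^k`, pool of Kolyvagin primes of index `≥ i₀`, depth `e₀`,
transverse structure `𝒯`, data `D` at the admissible conductors, signs `eb`. INPUTS: `h61c` (Čebotarev for a pair of
eigenclasses of opposite signs, primes of index `≥ k + j` beyond any bound — kernel, see `…KolyJSwapRowCorner`), `hPT` (duality
count at a relaxed prime, per sign), `pair ∕ hperf ∕ hrec` (local Tate pairing package), `κb ∕ hκSel ∕ h44c ∕ hκ0` (the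
level-`p` classes and their dictionary). CONCLUSION: from an admissible `c` whose datum is not `p^{i₀}`-divisible, an
admissible conductor over primes of index `≥ e₀` whose datum is not `p^{i₀}`-divisible.
[cite: McCallumLMS1991, §5 Prop. 5.2 (p. 304)] [cite: BurungaleEtAl2026, Prop. 2.2.1 (§2.2)] -/
theorem exists_deep_of_swapFamilies'
    (W : WeierstrassCurve ℚ) [W.IsElliptic] [W.IsGloballyMinimal] [NeZero (W.conductorNorm ℤ)]
    (K : Type) [Field K] [NumberField K] (p : ℕ) [Fact p.Prime]
    (Dt : ModularParametrizationData W (W.conductorNorm ℤ)) (β : ℤ) (ι : K →+* ℂ)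
    (τ : K ≃ₐ[ℚ] K) (k i₀ e₀ : ℕ) (hk : 1 ≤ k)
    (𝒯 : SelmerStructure ((W.baseChange K).torsionGaloisModule ((p ^ k : ℕ) : ℤ)))
    (D : ∀ s : {m : ℕ // Squarefree m ∧ ∀ q ∈ m.primeFactors,
        Zhang2014.IsKolyvaginPrime (W.conductorNorm ℤ) W K p q ∧ i₀ ≤ Zhang2014.kolyvaginIndex W p q},
      KolyvaginHeegnerData Dt β ι s.1)
    (eb : ℕ → Bool) (heb : ∀ (m ℓ : ℕ), ℓ.Prime → ¬ ℓ ∣ m → eb (m * ℓ) = !eb m)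
    -- Čebotarev for a pair of opposite-sign eigenclasses, deep primes beyond any bound (KERNEL: `…SwapRowCorner`)
    (h61c : ∀ (j : ℕ) (e : ℤ), (e = 1 ∨ e = -1) →
      ∀ (x y : galoisCohomology ((W.baseChange K).torsionGaloisModule ((p ^ k : ℕ) : ℤ)) 1),
      conjAct W τ ((p ^ k : ℕ) : ℤ) x = e • x → conjAct W τ ((p ^ k : ℕ) : ℤ) y = (-e) • y → y ≠ 0 →
      ∀ (b : ℕ), ∃ ℓ : ℕ, b < ℓ ∧ Zhang2014.IsKolyvaginPrime (W.conductorNorm ℤ) W K p ℓ ∧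
        k + j ≤ Zhang2014.kolyvaginIndex W p ℓ ∧
        ∀ v : HeightOneSpectrum (𝓞 K), (ℓ : 𝓞 K) ∈ v.asIdeal →
          addOrderOf (galoisCohomology.localization
              ((W.baseChange K).torsionGaloisModule ((p ^ k : ℕ) : ℤ)) (Sum.inr v) 1 x) = addOrderOf x ∧
          addOrderOf (galoisCohomology.localization
              ((W.baseChange K).torsionGaloisModule ((p ^ k : ℕ) : ℤ)) (Sum.inr v) 1 y) = addOrderOf y)
    -- global duality count at a relaxed prime, per sign (the walk's `hPT`)
    (hPT : ∀ (s : {m : ℕ // Squarefree m ∧ ∀ q ∈ m.primeFactors,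
        Zhang2014.IsKolyvaginPrime (W.conductorNorm ℤ) W K p q ∧ i₀ ≤ Zhang2014.kolyvaginIndex W p q})
      (ℓ : ℕ), Zhang2014.IsKolyvaginPrime (W.conductorNorm ℤ) W K p ℓ →
      i₀ ≤ Zhang2014.kolyvaginIndex W p ℓ → ¬ ℓ ∣ s.1 →
      ∀ v : HeightOneSpectrum (𝓞 K), (ℓ : 𝓞 K) ∈ v.asIdeal → ∀ b : Bool,
      Nat.card ((signPart W K τ ((p ^ k : ℕ) : ℤ) (if b then 1 else -1)
          ((selmerF W ((p ^ k : ℕ) : ℤ) 𝒯 (placesDividing K s.1)).relaxedAt {v}).selmerGroup).map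
        (galoisCohomology.localization ((W.baseChange K).torsionGaloisModule ((p ^ k : ℕ) : ℤ))
          (Sum.inr v) 1)) = p ^ k)
    -- the level-`p` local Tate pairing package
    {Z : Type} [AddCommGroup Z]
    (pair : ∀ v : HeightOneSpectrum (𝓞 K),
      galoisCohomology (((W.baseChange K).torsionGaloisModule ((p ^ k : ℕ) : ℤ)).toLocal (Sum.inr v)) 1 →+
      galoisCohomology (((W.baseChange K).torsionGaloisModule ((p ^ k : ℕ) : ℤ)).toLocal (Sum.inr v)) 1 →+ Z)
    (hperf : ∀ (ℓ : ℕ), Zhang2014.IsKolyvaginPrime (W.conductorNorm ℤ) W K p ℓ →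
      i₀ ≤ Zhang2014.kolyvaginIndex W p ℓ → ∀ v : HeightOneSpectrum (𝓞 K), (ℓ : 𝓞 K) ∈ v.asIdeal →
      ∀ (e : ℤ), (e = 1 ∨ e = -1) →
      ∀ (x y : galoisCohomology ((W.baseChange K).torsionGaloisModule ((p ^ k : ℕ) : ℤ)) 1),
      conjAct W τ ((p ^ k : ℕ) : ℤ) x = e • x → conjAct W τ ((p ^ k : ℕ) : ℤ) y = e • y →
      galoisCohomology.localization ((W.baseChange K).torsionGaloisModule ((p ^ k : ℕ) : ℤ)) (Sum.inr v) 1 x ∈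
        𝒯 (Sum.inr v) →
      galoisCohomology.localization ((W.baseChange K).torsionGaloisModule ((p ^ k : ℕ) : ℤ)) (Sum.inr v) 1 y ∈
        (W.baseChange K).kummerSelmerStructure ((p ^ k : ℕ) : ℤ) (Sum.inr v) →
      galoisCohomology.localization ((W.baseChange K).torsionGaloisModule ((p ^ k : ℕ) : ℤ)) (Sum.inr v) 1 x ≠ 0 →
      galoisCohomology.localization ((W.baseChange K).torsionGaloisModule ((p ^ k : ℕ) : ℤ)) (Sum.inr v) 1 y ≠ 0 →
      pair v (galoisCohomology.localization ((W.baseChange K).torsionGaloisModule ((p ^ k : ℕ) : ℤ)) (Sum.inr v) 1 x)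
        (galoisCohomology.localization ((W.baseChange K).torsionGaloisModule ((p ^ k : ℕ) : ℤ)) (Sum.inr v) 1 y) ≠ 0)
    (hrec : ∀ (s : {m : ℕ // Squarefree m ∧ ∀ q ∈ m.primeFactors,
        Zhang2014.IsKolyvaginPrime (W.conductorNorm ℤ) W K p q ∧ i₀ ≤ Zhang2014.kolyvaginIndex W p q})
      (ℓ₀ ℓ : ℕ), Zhang2014.IsKolyvaginPrime (W.conductorNorm ℤ) W K p ℓ₀ → i₀ ≤ Zhang2014.kolyvaginIndex W p ℓ₀ →
      Zhang2014.IsKolyvaginPrime (W.conductorNorm ℤ) W K p ℓ → i₀ ≤ Zhang2014.kolyvaginIndex W p ℓ →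
      ¬ ℓ₀ ∣ s.1 → ¬ ℓ ∣ s.1 → ℓ ≠ ℓ₀ →
      ∀ v₀ : HeightOneSpectrum (𝓞 K), (ℓ₀ : 𝓞 K) ∈ v₀.asIdeal →
      ∀ v : HeightOneSpectrum (𝓞 K), (ℓ : 𝓞 K) ∈ v.asIdeal → ∀ (b : Bool)
      (a c : galoisCohomology ((W.baseChange K).torsionGaloisModule ((p ^ k : ℕ) : ℤ)) 1),
      a ∈ signPart W K τ ((p ^ k : ℕ) : ℤ) (if b then 1 else -1)
        ((selmerF W ((p ^ k : ℕ) : ℤ) 𝒯 (placesDividing K s.1)).relaxedAt {v₀}).selmerGroup →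
      c ∈ signPart W K τ ((p ^ k : ℕ) : ℤ) (if b then 1 else -1)
        (selmerF W ((p ^ k : ℕ) : ℤ) 𝒯 (placesDividing K (s.1 * ℓ₀ * ℓ))).selmerGroup →
      pair v₀ (galoisCohomology.localization ((W.baseChange K).torsionGaloisModule ((p ^ k : ℕ) : ℤ))
          (Sum.inr v₀) 1 c)
        (galoisCohomology.localization ((W.baseChange K).torsionGaloisModule ((p ^ k : ℕ) : ℤ))
          (Sum.inr v₀) 1 a) +
      pair v (galoisCohomology.localization ((W.baseChange K).torsionGaloisModule ((p ^ k : ℕ) : ℤ))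
          (Sum.inr v) 1 c)
        (galoisCohomology.localization ((W.baseChange K).torsionGaloisModule ((p ^ k : ℕ) : ℤ))
          (Sum.inr v) 1 a) = 0)
    -- the level-`p` classes `κ̄_n` and their dictionary
    (κb : {m : ℕ // Squarefree m ∧ ∀ q ∈ m.primeFactors,
        Zhang2014.IsKolyvaginPrime (W.conductorNorm ℤ) W K p q ∧ i₀ ≤ Zhang2014.kolyvaginIndex W p q} →
      galoisCohomology ((W.baseChange K).torsionGaloisModule ((p ^ k : ℕ) : ℤ)) 1)
    (hκSel : ∀ s, κb s ∈ signPart W K τ ((p ^ k : ℕ) : ℤ) (if eb s.1 then 1 else -1)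
      (selmerF W ((p ^ k : ℕ) : ℤ) 𝒯 (placesDividing K s.1)).selmerGroup)
    (h44c : ∀ (s s' : {m : ℕ // Squarefree m ∧ ∀ q ∈ m.primeFactors,
        Zhang2014.IsKolyvaginPrime (W.conductorNorm ℤ) W K p q ∧ i₀ ≤ Zhang2014.kolyvaginIndex W p q}) (ℓ : ℕ),
      Zhang2014.IsKolyvaginPrime (W.conductorNorm ℤ) W K p ℓ → i₀ ≤ Zhang2014.kolyvaginIndex W p ℓ →
      ¬ ℓ ∣ s.1 → s'.1 = s.1 * ℓ → ∀ v : HeightOneSpectrum (𝓞 K), (ℓ : 𝓞 K) ∈ v.asIdeal →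
      (galoisCohomology.localization ((W.baseChange K).torsionGaloisModule ((p ^ k : ℕ) : ℤ)) (Sum.inr v) 1
          (κb s') = 0 ↔
        galoisCohomology.localization ((W.baseChange K).torsionGaloisModule ((p ^ k : ℕ) : ℤ)) (Sum.inr v) 1
          (κb s) = 0))
    (hκ0 : ∀ s, κb s ≠ 0 ↔ ¬ PDiv (D s) p i₀)
    -- the start
    (c : ℕ) (hc : Squarefree c ∧ ∀ q ∈ c.primeFactors,
      Zhang2014.IsKolyvaginPrime (W.conductorNorm ℤ) W K p q ∧ i₀ ≤ Zhang2014.kolyvaginIndex W p q)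
    (hc0 : ¬ PDiv (D ⟨c, hc⟩) p i₀) :
    ∃ s : {m : ℕ // Squarefree m ∧ ∀ q ∈ m.primeFactors,
        Zhang2014.IsKolyvaginPrime (W.conductorNorm ℤ) W K p q ∧ i₀ ≤ Zhang2014.kolyvaginIndex W p q},
      (∀ q ∈ s.1.primeFactors, e₀ ≤ Zhang2014.kolyvaginIndex W p q) ∧ ¬ PDiv (D s) p i₀ := by
  have hp : p.Prime := Fact.out
  -- ### the pool of primes `P`, the place `λ(ℓ)`
  let P : Type := {ℓ : ℕ // Zhang2014.IsKolyvaginPrime (W.conductorNorm ℤ) W K p ℓ ∧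
    i₀ ≤ Zhang2014.kolyvaginIndex W p ℓ}
  have hPprime : ∀ ℓ : P, (ℓ : ℕ).Prime := fun ℓ ↦ ℓ.2.1.1
  let lam : P → HeightOneSpectrum (𝓞 K) := fun ℓ ↦
    ⟨Ideal.span {((ℓ : ℕ) : 𝓞 K)}, ℓ.2.1.2.2.2.2.1, by
      rw [Ne, Ideal.span_singleton_eq_bot]
      exact_mod_cast (hPprime ℓ).ne_zero⟩
  have hlam_mem : ∀ ℓ : P, ((ℓ : ℕ) : 𝓞 K) ∈ (lam ℓ).asIdeal := fun ℓ ↦ Ideal.mem_span_singleton_self _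
  -- any place containing `ℓ` IS `λ(ℓ)`
  have hlam_eq : ∀ (ℓ : P) (v : HeightOneSpectrum (𝓞 K)), ((ℓ : ℕ) : 𝓞 K) ∈ v.asIdeal → v = lam ℓ :=
    fun ℓ v hv ↦ Walk.eq_of_natCast_mem_of_span_isPrime (hPprime ℓ).ne_zero ℓ.2.1.2.2.2.2.1 (hlam_mem ℓ) hv
  -- ### the conductors `∏ n`
  obtain ⟨cond, hcond⟩ : ∃ cond : Finset P → ℕ, ∀ n, cond n = 1 * ∏ ℓ ∈ n, (ℓ : ℕ) := ⟨_, fun _ ↦ rfl⟩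
  have hcond_insert : ∀ (n : Finset P) (ℓ : P), ℓ ∉ n → cond (insert ℓ n) = cond n * ℓ := by
    intro n ℓ hℓ
    rw [hcond, hcond, Finset.prod_insert hℓ]
    ring
  have hadm : ∀ n : Finset P, (Squarefree (cond n) ∧
      ∀ q ∈ (cond n).primeFactors, Zhang2014.IsKolyvaginPrime (W.conductorNorm ℤ) W K p q ∧
        i₀ ≤ Zhang2014.kolyvaginIndex W p q) ∧
      (∀ q ∈ (cond n).primeFactors, ∃ ℓ ∈ n, (ℓ : ℕ) = q) ∧
      (∀ ℓ : P, ℓ ∉ n → ¬ (ℓ : ℕ) ∣ cond n) := by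
    intro n
    obtain ⟨hsq, hfac, hnd⟩ := Walk.squarefree_mul_prod_facts (fun ℓ : P ↦ (ℓ : ℕ))
      Subtype.val_injective hPprime squarefree_one (fun ℓ h ↦ (hPprime ℓ).ne_one (Nat.dvd_one.mp h)) n
    rw [hcond]
    refine ⟨⟨hsq, fun q hq ↦ ?_⟩, fun q hq ↦ ?_, hnd⟩
    · rw [hfac, Nat.primeFactors_one, Finset.empty_union, Finset.mem_image] at hq
      obtain ⟨ℓ, -, rfl⟩ := hq
      exact ℓ.2
    · rw [hfac, Nat.primeFactors_one, Finset.empty_union, Finset.mem_image] at hq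
      obtain ⟨ℓ, hℓ, rfl⟩ := hq
      exact ⟨ℓ, hℓ, rfl⟩
  let sadm : Finset P → {m : ℕ // Squarefree m ∧ ∀ q ∈ m.primeFactors,
      Zhang2014.IsKolyvaginPrime (W.conductorNorm ℤ) W K p q ∧ i₀ ≤ Zhang2014.kolyvaginIndex W p q} :=
    fun n ↦ ⟨cond n, (hadm n).1⟩
  have hsadm_insert : ∀ (n : Finset P) (ℓ : P), ℓ ∉ n → (sadm (insert ℓ n)).1 = (sadm n).1 * ℓ :=
    fun n ℓ hℓ ↦ hcond_insert n ℓ hℓ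
  have hcond0 : ∀ n : Finset P, cond n ≠ 0 := fun n ↦ (hadm n).1.1.ne_zero
  have hlam_not : ∀ (n : Finset P) (ℓ : P), ℓ ∉ n → lam ℓ ∉ placesDividing K (cond n) :=
    fun n ℓ hℓ ↦ Walk.not_mem_placesDividing_of_not_dvd (hPprime ℓ) (hlam_mem ℓ) ((hadm n).2.2 ℓ hℓ)
  have hplaces_insert : ∀ (n : Finset P) (ℓ : P), ℓ ∉ n →
      placesDividing K (cond (insert ℓ n)) = insert (lam ℓ) (placesDividing K (cond n)) := by
    intro n ℓ hℓ
    rw [hcond_insert n ℓ hℓ]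
    exact Walk.placesDividing_mul_eq_insert (hcond0 n) (hPprime ℓ) ℓ.2.1.2.2.2.2.1 (hlam_mem ℓ)
  -- ### the starting conductor as a finset of `P`
  let n₀ : Finset P := c.primeFactors.subtype fun ℓ ↦
    Zhang2014.IsKolyvaginPrime (W.conductorNorm ℤ) W K p ℓ ∧ i₀ ≤ Zhang2014.kolyvaginIndex W p ℓ
  have hn₀ : cond n₀ = c := by
    rw [hcond, one_mul]
    have h1 : ∏ ℓ ∈ n₀, (ℓ : ℕ) = ∏ q ∈ n₀.map (Function.Embedding.subtype _), q := by
      simp only [Finset.prod_map, Function.Embedding.coe_subtype]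
      rfl
    rw [h1, Finset.subtype_map, Finset.filter_true_of_mem (fun q hq ↦ hc.2 q hq)]
    exact Nat.prod_primeFactors_of_squarefree hc.1
  have hsadm₀ : sadm n₀ = ⟨c, hc⟩ := Subtype.ext hn₀
  -- shorthand for the localisation
  let loc : ∀ ℓ : P, galoisCohomology ((W.baseChange K).torsionGaloisModule ((p ^ k : ℕ) : ℤ)) 1 →+
      galoisCohomology (((W.baseChange K).torsionGaloisModule ((p ^ k : ℕ) : ℤ)).toLocal (Sum.inr (lam ℓ))) 1 :=
    fun ℓ ↦ galoisCohomology.localization ((W.baseChange K).torsionGaloisModule ((p ^ k : ℕ) : ℤ))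
      (Sum.inr (lam ℓ)) 1
  -- ### the abstract swap, instantiated
  have key := JET.Section6.exists_deep_conductor_of_swap (P := P)
    (loc := loc)
    (Hf := fun ℓ b ↦ (W.baseChange K).kummerSelmerStructure ((p ^ k : ℕ) : ℤ) (Sum.inr (lam ℓ)) ⊓
      (signPart W K τ ((p ^ k : ℕ) : ℤ) (if b then 1 else -1) ⊤).map (loc ℓ))
    (Htr := fun ℓ b ↦ 𝒯 (Sum.inr (lam ℓ)) ⊓ (signPart W K τ ((p ^ k : ℕ) : ℤ) (if b then 1 else -1) ⊤).map (loc ℓ))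
    (Gs := fun b ↦ signPart W K τ ((p ^ k : ℕ) : ℤ) (if b then 1 else -1) ⊤)
    (Sel := fun n b ↦ signPart W K τ ((p ^ k : ℕ) : ℤ) (if b then 1 else -1)
      (selmerF W ((p ^ k : ℕ) : ℤ) 𝒯 (placesDividing K (cond n))).selmerGroup)
    (Rel := fun n ℓ b ↦ signPart W K τ ((p ^ k : ℕ) : ℤ) (if b then 1 else -1)
      ((selmerF W ((p ^ k : ℕ) : ℤ) 𝒯 (placesDividing K (cond n))).relaxedAt {lam ℓ}).selmerGroup)
    ?hSelGs ?hRelGs ?hSelT ?hRelf ?haux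
    (Deep := fun ℓ ↦ e₀ ≤ Zhang2014.kolyvaginIndex W p (ℓ : ℕ)) ?h61
    (pair := fun ℓ ↦ pair (lam ℓ)) ?hperf ?hrec
    (e := fun n ↦ eb (cond n)) ?he
    (κ := fun n ↦ κb (sadm n)) ?hκ ?h44 n₀ ?hn₀
  · -- read the conclusion
    obtain ⟨n', hdeep, -, hκ'⟩ := key
    refine ⟨sadm n', fun q hq ↦ ?_, (hκ0 (sadm n')).mp hκ'⟩
    obtain ⟨ℓ, hℓ, rfl⟩ := (hadm n').2.1 q hq
    exact hdeep ℓ hℓ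
  case hSelGs =>
    intro n b
    exact Walk.signPart_le_signPart_top W K τ _ _ _
  case hRelGs =>
    intro n ℓ b _
    exact Walk.signPart_le_signPart_top W K τ _ _ _
  case hSelT =>
    intro n ℓ b hℓ x hx
    have hx' := hx
    rw [show signPart W K τ _ _ (selmerF W _ 𝒯 (placesDividing K (cond (insert ℓ n)))).selmerGroup =
        signPart W K τ _ _ (((selmerF W _ 𝒯 (placesDividing K (cond n))).relaxedAt {lam ℓ}).selmerGroup) ⊓
          (𝒯 (Sum.inr (lam ℓ))).comap (loc ℓ) by
      rw [hplaces_insert n ℓ hℓ, ← Walk.signPart_inf_right]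
      congr 1
      exact Walk.selmerGroup_transverseAt_insert _ 𝒯 _ (lam ℓ)] at hx'
    refine AddSubgroup.mem_comap.mpr (AddSubgroup.mem_inf.mpr ⟨(AddSubgroup.mem_comap.mp hx'.2), ?_⟩)
    exact AddSubgroup.mem_map_of_mem _ (Walk.signPart_le_signPart_top W K τ _ _ _ hx)
  case hRelf =>
    intro n ℓ₀ ℓ b hℓ₀ hℓ hne x hx
    rw [mem_signPart_iff] at hx
    obtain ⟨hxR, hxe⟩ := hx
    have hloc := (SelmerStructure.mem_selmerGroup_iff _ _).mp hxR (Sum.inr (lam ℓ))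
    have hlamne : lam ℓ ≠ lam ℓ₀ := by
      intro h
      apply hne
      apply Subtype.ext
      have h1 : ((ℓ₀ : ℕ) : 𝓞 K) ∈ (lam ℓ).asIdeal := h ▸ hlam_mem ℓ₀
      by_contra hne'
      exact not_natCast_mem_of_prime_ne (hPprime ℓ) (hPprime ℓ₀) hne' (lam ℓ) (hlam_mem ℓ) h1
    have hcond_at : ((selmerF W ((p ^ k : ℕ) : ℤ) 𝒯 (placesDividing K (cond n))).relaxedAt {lam ℓ₀})
        (Sum.inr (lam ℓ)) = (W.baseChange K).kummerSelmerStructure ((p ^ k : ℕ) : ℤ) (Sum.inr (lam ℓ)) := by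
      rw [SelmerStructure.relaxedAt, SelmerStructure.modify_inr_of_not_mem _ _
        (by rwa [Finset.mem_singleton]) (Finset.notMem_empty _) (Finset.notMem_empty _), selmerF,
        SelmerStructure.transverseAt, SelmerStructure.modify_inr_of_not_mem _ _ (Finset.notMem_empty _)
        (Finset.notMem_empty _) (hlam_not n ℓ hℓ)]
    rw [hcond_at] at hloc
    refine AddSubgroup.mem_comap.mpr (AddSubgroup.mem_inf.mpr ⟨hloc, ?_⟩)
    exact AddSubgroup.mem_map_of_mem _ ((Walk.mem_signPart_top_iff W K τ _ _ x).mpr hxe)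
  case haux =>
    intro n ℓ₀ b hℓ₀
    have hcard := hPT (sadm n) ℓ₀ ℓ₀.2.1 ℓ₀.2.2 ((hadm n).2.2 ℓ₀ hℓ₀) (lam ℓ₀) (hlam_mem ℓ₀) b
    have hpk : p ^ k ≠ 1 := (Nat.one_lt_pow (by omega) hp.one_lt).ne'
    have hne : (signPart W K τ ((p ^ k : ℕ) : ℤ) (if b then 1 else -1)
        ((selmerF W ((p ^ k : ℕ) : ℤ) 𝒯 (placesDividing K (cond n))).relaxedAt {lam ℓ₀}).selmerGroup).map
          (loc ℓ₀) ≠ ⊥ := by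
      intro h
      rw [h, AddSubgroup.card_bot] at hcard
      exact hpk hcard.symm
    obtain ⟨y, hy, hy0⟩ := (AddSubgroup.bot_or_exists_ne_zero _).resolve_left hne
    obtain ⟨x, hx, rfl⟩ := AddSubgroup.mem_map.mp hy
    exact ⟨x, hx, fun h ↦ hy0 (by rw [h, map_zero])⟩
  case h61 =>
    intro b x y hx hy hx0 hy0 n
    rw [Walk.mem_signPart_top_iff] at hx hy
    have hes : ((if b then (1 : ℤ) else -1) = 1 ∨ (if b then (1 : ℤ) else -1) = -1) := by
      cases b <;> simp
    have hy' : conjAct W τ ((p ^ k : ℕ) : ℤ) y = (-(if b then (1 : ℤ) else -1)) • y := by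
      rw [hy]; cases b <;> simp
    obtain ⟨ℓ₁, hbℓ, hZ, hidx, hord⟩ := h61c (i₀ + e₀) _ hes x y hx hy' hy0 (cond n)
    have hi₀ : i₀ ≤ Zhang2014.kolyvaginIndex W p ℓ₁ := by omega
    have hndvd : ¬ ℓ₁ ∣ cond n := fun h ↦ by
      have := Nat.le_of_dvd (Nat.pos_of_ne_zero (hcond0 n)) h
      omega
    refine ⟨⟨ℓ₁, hZ, hi₀⟩, (show e₀ ≤ Zhang2014.kolyvaginIndex W p ℓ₁ by omega), fun hmem ↦ hndvd ?_, ?_, ?_⟩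
    · rw [hcond]; exact dvd_mul_of_dvd_right (Finset.dvd_prod_of_mem _ hmem) 1
    · intro h
      have h1 := (hord (lam ⟨ℓ₁, hZ, hi₀⟩) (hlam_mem _)).1
      rw [show loc ⟨ℓ₁, hZ, hi₀⟩ x = galoisCohomology.localization _ (Sum.inr (lam ⟨ℓ₁, hZ, hi₀⟩)) 1 x from rfl]
        at h
      rw [h, addOrderOf_zero] at h1
      exact hx0 (AddMonoid.addOrderOf_eq_one_iff.mp h1.symm)
    · intro h
      have h1 := (hord (lam ⟨ℓ₁, hZ, hi₀⟩) (hlam_mem _)).2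
      rw [show loc ⟨ℓ₁, hZ, hi₀⟩ y = galoisCohomology.localization _ (Sum.inr (lam ⟨ℓ₁, hZ, hi₀⟩)) 1 y from rfl]
        at h
      rw [h, addOrderOf_zero] at h1
      exact hy0 (AddMonoid.addOrderOf_eq_one_iff.mp h1.symm)
  case hperf =>
    intro ℓ b x y hx hy hx0 hy0
    obtain ⟨hxT, hxs⟩ := AddSubgroup.mem_inf.mp hx
    obtain ⟨hyK, hys⟩ := AddSubgroup.mem_inf.mp hy
    obtain ⟨x', hx', rfl⟩ := AddSubgroup.mem_map.mp hxs
    obtain ⟨y', hy', rfl⟩ := AddSubgroup.mem_map.mp hys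
    rw [Walk.mem_signPart_top_iff] at hx' hy'
    have hes : ((if b then (1 : ℤ) else -1) = 1 ∨ (if b then (1 : ℤ) else -1) = -1) := by
      cases b <;> simp
    exact hperf ℓ ℓ.2.1 ℓ.2.2 (lam ℓ) (hlam_mem ℓ) _ hes x' y' hx' hy' hxT hyK hx0 hy0
  case hrec =>
    intro n ℓ₀ ℓ b a c' hℓ₀ hℓ hne ha hc'
    have hne' : (ℓ : ℕ) ≠ (ℓ₀ : ℕ) := fun h ↦ hne (Subtype.ext h)
    have hℓ₀' : ℓ₀ ∉ n := hℓ₀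
    have hℓn' : ℓ ∉ insert ℓ₀ n := by
      rw [Finset.mem_insert, not_or]; exact ⟨hne, hℓ⟩
    have hcond2 : cond (insert ℓ (insert ℓ₀ n)) = cond n * ℓ₀ * ℓ := by
      rw [hcond_insert _ ℓ hℓn', hcond_insert n ℓ₀ hℓ₀]
    have hc'' : c' ∈ signPart W K τ ((p ^ k : ℕ) : ℤ) (if b then 1 else -1)
        (selmerF W ((p ^ k : ℕ) : ℤ) 𝒯 (placesDividing K ((sadm n).1 * ℓ₀ * ℓ))).selmerGroup := by
      rw [show (sadm n).1 = cond n from rfl, ← hcond2]; exact hc'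
    exact hrec (sadm n) ℓ₀ ℓ ℓ₀.2.1 ℓ₀.2.2 ℓ.2.1 ℓ.2.2 ((hadm n).2.2 ℓ₀ hℓ₀) ((hadm n).2.2 ℓ hℓ) hne'
      (lam ℓ₀) (hlam_mem ℓ₀) (lam ℓ) (hlam_mem ℓ) b a c' ha hc''
  case he =>
    intro n ℓ hℓ
    show eb (cond (insert ℓ n)) = !eb (cond n)
    rw [hcond_insert n ℓ hℓ]
    exact heb (cond n) ℓ (hPprime ℓ) ((hadm n).2.2 ℓ hℓ)
  case hκ =>
    intro n
    exact hκSel (sadm n)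
  case h44 =>
    intro n ℓ hℓ
    exact h44c (sadm n) (sadm (insert ℓ n)) ℓ ℓ.2.1 ℓ.2.2 ((hadm n).2.2 ℓ hℓ) (hsadm_insert n ℓ hℓ) (lam ℓ)
      (hlam_mem ℓ)
  case hn₀ =>
    show κb (sadm n₀) ≠ 0
    rw [hsadm₀]
    exact (hκ0 ⟨c, hc⟩).mpr hc0


end Summit.BirchSwinnertonDyer.Rank1Residual.X11b.Three.Koly

end
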